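import Summits.QuantumFields.YangMills.Theorems.FluctuationComparisonRegPrIntLS2BetaRelativeOneLevelStepArc
import Summits.QuantumFields.YangMills.Theorems.FluctuationComparisonRegPrIntLS2BetaRelativeHstepHjBkg
import HarnessLib

/-!
# S2β · letter (D♮)∕(D-stage) REL-TEL, the (C)-half — THE RELATIVE `hstep` ∕ `hj` PAIR OF ONE LEVEL, ARC-LINEAR AND BACKGROUND-PRICED
# (✓∕⧗`relOneLevelStep_arc` packaged for ✓p823396 `relKeyLemma_level` ∕ ✓p825006 `relKeyLemma_torus_of_step`: TWO local data `β_W` (loops), `β_A` (open transports),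
# TWO suppliers; the `ℓ²` source `ε·‖δ‖₂ + η·‖bdev‖₂` with `η ∝ κ_W·cWβ + κ_A·cAβ + 5L³θ₀` — BKG as soon as the LOOP supplier's bdev coefficient `cWβ` is (Stokes:
# `cWβ ∝ θ₀`), the window sups `β_W♯, β_A♯` sitting only in `κ_W` (multiplying `β_W`) and in the BKG-carrying `κ_A = 7·10⁵((d+2)L)²θ₀(1 + 20β_A♯)`)

Cell `ym3-torus` (rung R3 = continuum `SU(2)` Yang–Mills on the three-torus — NOT d = 4, NOT infinite volume, NOT a mass gap, NOT Clay).
Width seat «width 10» `ym3-torus-px10` (gen 23), FREE px helper on crux `stmt-QuantumFields-20520`, count-neutral, DEFINITION-FREE; own-risk brick of the px10 lane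
«(C)-half of letter (D♮)» (UV3-NODE §82; self-audit FINDING 14:09Z).  ★★★ `relHstep_hj_arc`: with `f p := δ_p`, `f′ Q := dist1(Ū₀(∂Q)⁻¹Ū(∂Q))`, `g c := dist1(bdev U U₀ c)`,
local data `0 ≤ β_W Q ≤ β_W♯`, `0 ≤ β_A Q ≤ β_A♯` (both `≤ 1∕12800`) SUPPLIED by `β_W Q ≤ cWβ·Σ_{near}g + cWε·Σ_{near}f`, `β_A Q ≤ cAβ·Σ_{near}g + cAε·Σ_{near}f`:
(hstep) `f′ Q ≤ (1 + 26((d+2)L)²θ)·Σ_p K Q p·f p + j Q`, `j Q := κ_W·β_W Q + κ_A·β_A Q + 5L³θ₀·Σ_{fwd-near}g`, `κ_W := 700000((d+2)L)²θ₀ + 2800000β_W♯ + 7000000β_A♯`,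
`κ_A := 700000((d+2)L)²θ₀ + 14000000((d+2)L)²θ₀·β_A♯`; (hj) `√Σ_Q j_Q² ≤ (κ_W·cWε + κ_A·cAε)·√((3^dL^dd²)(3^dd²))·‖f‖₂ + (κ_W·cWβ + κ_A·cAβ + 5L³θ₀)·√((3^dL^dd)(3^dd²))·‖g‖₂`.

HONEST SCOPE.  Packaging over landed∕signed letters; nothing of Bałaban's asserted; the suppliers, `β♯`s, BKG-tower, (H♭♭), (D-stage), GAP♯∘ (`stub_uniformFibreGapOrbit`), S2β,
crux 20520 and `YM3TorusSU2` are NOT proved; no registered stub is closed; the Yang–Mills mass gap is NOT proved.  Sorry-free, axioms standard.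
References: T. Bałaban, CMP **99** (1985) 75–102 [Balaban1985RegularSpaces] (Lemma 1 p.79); CMP **109** (1987) 249–301 [Balaban1987RG1] ((0.1)–(0.4) pp.252–253).
-/

set_option autoImplicit false

noncomputable section

namespace Summit.QuantumFields.YangMills.Theorems.FluctuationComparisonRegPrIntLS2BetaRelativeHstepHjArc

open NormedSpace Finset
open scoped BigOperators
open Literature.MathematicalPhysics.QuantumFieldTheory.Balaban1983to89
open Literature.MathematicalPhysics.QuantumFieldTheory.Balaban1983to89.T4Continuum
open Literature.MathematicalPhysics.QuantumFieldTheory.Balaban1983to89.AveragingRT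
open Literature.MathematicalPhysics.QuantumFieldTheory.Balaban1983to89.BlockAveraging
open Literature.MathematicalPhysics.QuantumFieldTheory.Balaban1983to89.ExpMeanLog (expMeanLogSU deltaSU)
open Literature.MathematicalPhysics.QuantumFieldTheory.Balaban1983to89.T4TiltOscillation (bdev)
open B10Eq47AxialChi (shiftN)
open Summit.QuantumFields.YangMills.Theorems.FluctuationComparisonRegPrIntLS2BetaRelativeOneLevelStepArc (relOneLevelStep_arc)
open Summit.QuantumFields.YangMills.Theorems.FluctuationComparisonRegPrIntLS2BetaRelativeHstepHjBkg (fineBond_nbhd3_schur)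

variable {P : Params} {j : ℕ}

/-! ## The arc-linear relative `hstep` ∕ `hj` pair -/

variable {n : Type*} [Fintype n] [DecidableEq n] [Nonempty n]

/-- ★★★ **THE RELATIVE `hstep` ∕ `hj` PAIR, ARC-LINEAR AND BACKGROUND-PRICED** (see the module docstring for the data; standing range,
`PlaqSmall θ U` with `((d+2)L)²θ ≤ 1∕800`, guard, `PlaqSmall θ₀ U₀`, `0 ≤ θ₀ ≤ θ`). [cite: Balaban1985RegularSpaces, Lemma 1 p.79] -/
theorem relHstep_hj_arc (hj : j + 1 ≤ P.m + P.K) (U U₀ : GaugeField P j (Matrix.specialUnitaryGroup n ℂ)) {θ θ₀ : ℝ} (hθ00 : 0 ≤ θ₀) (hθ₀θ : θ₀ ≤ θ)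
    (hθ : (((P.d + 2) * P.L : ℕ) : ℝ) ^ 2 * θ ≤ 1 / 800) (hδ : (((P.d + 2) * P.L : ℕ) : ℝ) ^ 2 / 4 * θ < deltaSU n)
    (hU : PlaqSmall θ U) (hU₀ : PlaqSmall θ₀ U₀) (βW βA : Plaq P (j + 1) → ℝ) (hβW0 : ∀ Q, 0 ≤ βW Q) (hβA0 : ∀ Q, 0 ≤ βA Q)
    {βWs βAs cWβ cWε cAβ cAε : ℝ} (hβWs0 : 0 ≤ βWs) (hβAs0 : 0 ≤ βAs) (hβWsup : ∀ Q, βW Q ≤ βWs) (hβAsup : ∀ Q, βA Q ≤ βAs)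
    (hβWs : βWs ≤ 1 / 12800) (hβAs : βAs ≤ 1 / 12800) (hcWβ : 0 ≤ cWβ) (hcWε : 0 ≤ cWε) (hcAβ : 0 ≤ cAβ) (hcAε : 0 ≤ cAε)
    (hW : ∀ (Q : Plaq P (j + 1)) (c : PBond P (j + 1)), (c = ⟨Q.src, Q.μ⟩ ∨ c = ⟨Q.src.shift Q.μ, Q.ν⟩ ∨ c = ⟨Q.src.shift Q.ν, Q.μ⟩ ∨ c = ⟨Q.src, Q.ν⟩) →
      ∀ i, dist1 ((loopHol U₀ c i)⁻¹ * loopHol U c i) ≤ βW Q)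
    (hA : ∀ (Q : Plaq P (j + 1)) (c : PBond P (j + 1)), (c = ⟨Q.src, Q.μ⟩ ∨ c = ⟨Q.src.shift Q.μ, Q.ν⟩ ∨ c = ⟨Q.src.shift Q.ν, Q.μ⟩ ∨ c = ⟨Q.src, Q.ν⟩) →
      dist1 ((axialAvg U₀ c)⁻¹ * axialAvg U c) ≤ βA Q)
    (hS : ∀ (Q : Plaq P (j + 1)) (i : Idx P),
      dist1 ((holAt U₀ (walk (emb Q.src) (stairWord i.2.1 (off i.1))))⁻¹ * holAt U (walk (emb Q.src) (stairWord i.2.1 (off i.1)))) ≤ βA Q)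
    (hβWsupp : ∀ Q : Plaq P (j + 1), βW Q ≤ cWβ * ∑ c ∈ Finset.univ.filter (fun c : PBond P j => ∀ κ, blockOf c.src κ = Q.src κ ∨ blockOf c.src κ = Q.src κ + 1 ∨
      blockOf c.src κ = Q.src κ - 1), dist1 (bdev U U₀ c) +
      cWε * ∑ q ∈ Finset.univ.filter (fun q : Plaq P j => ∀ κ, blockOf q.src κ = Q.src κ ∨ blockOf q.src κ = Q.src κ + 1 ∨
      blockOf q.src κ = Q.src κ - 1), dist1 ((GaugeField.plaqHol U₀ q)⁻¹ * GaugeField.plaqHol U q))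
    (hβAsupp : ∀ Q : Plaq P (j + 1), βA Q ≤ cAβ * ∑ c ∈ Finset.univ.filter (fun c : PBond P j => ∀ κ, blockOf c.src κ = Q.src κ ∨ blockOf c.src κ = Q.src κ + 1 ∨
      blockOf c.src κ = Q.src κ - 1), dist1 (bdev U U₀ c) +
      cAε * ∑ q ∈ Finset.univ.filter (fun q : Plaq P j => ∀ κ, blockOf q.src κ = Q.src κ ∨ blockOf q.src κ = Q.src κ + 1 ∨
      blockOf q.src κ = Q.src κ - 1), dist1 ((GaugeField.plaqHol U₀ q)⁻¹ * GaugeField.plaqHol U q)) :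
    (∀ Q : Plaq P (j + 1), dist1 ((GaugeField.plaqHol (avgFun (expMeanLogSU (n := n)) U₀) Q)⁻¹ * GaugeField.plaqHol (avgFun (expMeanLogSU (n := n)) U) Q) ≤
      (1 + 26 * ((((P.d + 2) * P.L : ℕ) : ℝ) ^ 2 * θ)) *
          ∑ p : Plaq P j, ((P.L : ℝ) ^ P.d)⁻¹ * (((block Q.src).filter (fun x : Site P j => p.μ = Q.μ ∧ p.ν = Q.ν ∧
            ∃ a ∈ range P.L, ∃ b ∈ range P.L, p.src = shiftN (shiftN x Q.μ a) Q.ν b)).card : ℝ) *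
            dist1 ((GaugeField.plaqHol U₀ p)⁻¹ * GaugeField.plaqHol U p) +
        ((700000 * ((((P.d + 2) * P.L : ℕ) : ℝ) ^ 2 * θ₀) + 2800000 * βWs + 7000000 * βAs) * βW Q + (700000 * ((((P.d + 2) * P.L : ℕ) : ℝ) ^ 2 * θ₀) + 14000000 * ((((P.d + 2) * P.L : ℕ) : ℝ) ^ 2 * θ₀) * βAs) * βA Q +
          5 * (P.L : ℝ) ^ 3 * θ₀ * ∑ c ∈ Finset.univ.filter (fun c : PBond P j => ∀ κ, blockOf c.src κ = Q.src κ ∨ blockOf c.src κ = Q.src κ + 1),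
            dist1 (bdev U U₀ c))) ∧
    √(∑ Q : Plaq P (j + 1), ((700000 * ((((P.d + 2) * P.L : ℕ) : ℝ) ^ 2 * θ₀) + 2800000 * βWs + 7000000 * βAs) * βW Q + (700000 * ((((P.d + 2) * P.L : ℕ) : ℝ) ^ 2 * θ₀) + 14000000 * ((((P.d + 2) * P.L : ℕ) : ℝ) ^ 2 * θ₀) * βAs) * βA Q +
          5 * (P.L : ℝ) ^ 3 * θ₀ * ∑ c ∈ Finset.univ.filter (fun c : PBond P j => ∀ κ, blockOf c.src κ = Q.src κ ∨ blockOf c.src κ = Q.src κ + 1),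
            dist1 (bdev U U₀ c)) ^ 2) ≤
      ((700000 * ((((P.d + 2) * P.L : ℕ) : ℝ) ^ 2 * θ₀) + 2800000 * βWs + 7000000 * βAs) * cWε + (700000 * ((((P.d + 2) * P.L : ℕ) : ℝ) ^ 2 * θ₀) + 14000000 * ((((P.d + 2) * P.L : ℕ) : ℝ) ^ 2 * θ₀) * βAs) * cAε) * √(((3 ^ P.d * P.L ^ P.d * P.d ^ 2 : ℕ) : ℝ) * ((3 ^ P.d * P.d ^ 2 : ℕ) : ℝ)) *
          √(∑ q : Plaq P j, dist1 ((GaugeField.plaqHol U₀ q)⁻¹ * GaugeField.plaqHol U q) ^ 2) +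
      ((700000 * ((((P.d + 2) * P.L : ℕ) : ℝ) ^ 2 * θ₀) + 2800000 * βWs + 7000000 * βAs) * cWβ + (700000 * ((((P.d + 2) * P.L : ℕ) : ℝ) ^ 2 * θ₀) + 14000000 * ((((P.d + 2) * P.L : ℕ) : ℝ) ^ 2 * θ₀) * βAs) * cAβ + 5 * (P.L : ℝ) ^ 3 * θ₀) *
        √(((3 ^ P.d * P.L ^ P.d * P.d : ℕ) : ℝ) * ((3 ^ P.d * P.d ^ 2 : ℕ) : ℝ)) * √(∑ c : PBond P j, dist1 (bdev U U₀ c) ^ 2) := by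
  classical
  set T₀ : ℝ := (((P.d + 2) * P.L : ℕ) : ℝ) ^ 2 * θ₀ with hT₀
  have hT0 : 0 ≤ T₀ := by positivity
  have hL3 : 0 ≤ (P.L : ℝ) ^ 3 * θ₀ := by positivity
  set κW : ℝ := 700000 * T₀ + 2800000 * βWs + 7000000 * βAs with hκW
  set κA : ℝ := 700000 * T₀ + 14000000 * T₀ * βAs with hκA
  have hκW0 : 0 ≤ κW := by positivity
  have hκA0 : 0 ≤ κA := by positivity
  -- the per-Q forward-near and 3-near sums of `g`, and the 3-near sums of `f`
  set g : PBond P j → ℝ := fun c => dist1 (bdev U U₀ c) with hg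
  have hg0 : ∀ c, 0 ≤ g c := fun c => GaugeGroup.dist1_nonneg _
  set N2 : Plaq P (j + 1) → ℝ := fun Q => ∑ c ∈ Finset.univ.filter (fun c : PBond P j => ∀ κ, blockOf c.src κ = Q.src κ ∨ blockOf c.src κ = Q.src κ + 1), g c with hN2
  set N3 : Plaq P (j + 1) → ℝ := fun Q => ∑ c ∈ Finset.univ.filter (fun c : PBond P j => ∀ κ, blockOf c.src κ = Q.src κ ∨ blockOf c.src κ = Q.src κ + 1 ∨
      blockOf c.src κ = Q.src κ - 1), g c with hN3
  set fδ : Plaq P j → ℝ := fun q => dist1 ((GaugeField.plaqHol U₀ q)⁻¹ * GaugeField.plaqHol U q) with hfδ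
  have hfδ0 : ∀ q, 0 ≤ fδ q := fun q => GaugeGroup.dist1_nonneg _
  set M3 : Plaq P (j + 1) → ℝ := fun Q => ∑ q ∈ Finset.univ.filter (fun q : Plaq P j => ∀ κ, blockOf q.src κ = Q.src κ ∨ blockOf q.src κ = Q.src κ + 1 ∨
      blockOf q.src κ = Q.src κ - 1), fδ q with hM3
  have hN2le : ∀ Q, N2 Q ≤ N3 Q := fun Q => by
    refine Finset.sum_le_sum_of_subset_of_nonneg (fun c hc => ?_) (fun c _ _ => hg0 c)
    rw [Finset.mem_filter] at hc ⊢
    exact ⟨hc.1, fun κ => (hc.2 κ).elim Or.inl (fun h => Or.inr (Or.inl h))⟩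
  have hN20 : ∀ Q, 0 ≤ N2 Q := fun Q => Finset.sum_nonneg fun c _ => hg0 c
  have hN30 : ∀ Q, 0 ≤ N3 Q := fun Q => Finset.sum_nonneg fun c _ => hg0 c
  have hM30 : ∀ Q, 0 ≤ M3 Q := fun Q => Finset.sum_nonneg fun q _ => hfδ0 q
  refine ⟨fun Q => ?_, ?_⟩
  · -- (hstep): ✓`relOneLevelStep_arc` with `γ := N2 Q`; then the quadratic terms linearised by the sups
    have h := relOneLevelStep_arc hj U U₀ hθ00 hθ₀θ hθ hδ hU hU₀ Q (hβW0 Q) (hβA0 Q) ((hβWsup Q).trans hβWs) ((hβAsup Q).trans hβAs) (hW Q) (hA Q) (hS Q)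
      (γ := N2 Q) (fun c hc => Finset.single_le_sum (f := g) (fun c' _ => hg0 c') (Finset.mem_filter.mpr ⟨Finset.mem_univ c, hc⟩))
    have q1 : βW Q ^ 2 ≤ βWs * βW Q := by rw [sq]; exact mul_le_mul_of_nonneg_right (hβWsup Q) (hβW0 Q)
    have q2 : βW Q * βA Q ≤ βAs * βW Q := by rw [mul_comm]; exact mul_le_mul_of_nonneg_right (hβAsup Q) (hβW0 Q)
    have q3' : βA Q * βA Q ≤ βAs * βA Q := mul_le_mul_of_nonneg_right (hβAsup Q) (hβA0 Q)
    have hT0' : 0 ≤ (((P.d + 2) * P.L : ℕ) : ℝ) ^ 2 * θ₀ := by positivity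
    have q3 : (((P.d + 2) * P.L : ℕ) : ℝ) ^ 2 * θ₀ * βA Q ^ 2 ≤ (((P.d + 2) * P.L : ℕ) : ℝ) ^ 2 * θ₀ * βAs * βA Q := by nlinarith only [q3', hT0']
    rw [hκW, hκA, hT₀]
    linarith only [h, q1, q2, q3]
  · -- (hj): `j Q ≤ A·N3 Q + B·M3 Q`, Minkowski, then the two Schur bounds (bonds: ✓p824969 §1; plaquettes: ✓p817170)
    set A : ℝ := κW * cWβ + κA * cAβ + 5 * (P.L : ℝ) ^ 3 * θ₀ with hA'
    set B : ℝ := κW * cWε + κA * cAε with hB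
    have hA0 : 0 ≤ A := by positivity
    have hB0 : 0 ≤ B := by positivity
    have hjQ : ∀ Q, κW * βW Q + κA * βA Q + 5 * (P.L : ℝ) ^ 3 * θ₀ * N2 Q ≤ A * N3 Q + B * M3 Q := fun Q => by
      have h1 := mul_le_mul_of_nonneg_left (hβWsupp Q) hκW0
      have h2 := mul_le_mul_of_nonneg_left (hβAsupp Q) hκA0
      have h3 := mul_le_mul_of_nonneg_left (hN2le Q) hL3
      calc κW * βW Q + κA * βA Q + 5 * (P.L : ℝ) ^ 3 * θ₀ * N2 Q
          ≤ κW * (cWβ * N3 Q + cWε * M3 Q) + κA * (cAβ * N3 Q + cAε * M3 Q) + 5 * ((P.L : ℝ) ^ 3 * θ₀) * N3 Q := by linarith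
        _ = A * N3 Q + B * M3 Q := by rw [hA', hB]; ring
    have hj0 : ∀ Q, 0 ≤ κW * βW Q + κA * βA Q + 5 * (P.L : ℝ) ^ 3 * θ₀ * N2 Q := fun Q => by
      have := hβW0 Q; have := hβA0 Q; have := hN20 Q; positivity
    have hMink := FluctuationComparisonRegPrIntLS2BetaKeyLemmaSkeleton.sqrt_sum_sq_le_of_le_add Finset.univ
      (fun Q => κW * βW Q + κA * βA Q + 5 * (P.L : ℝ) ^ 3 * θ₀ * N2 Q) (fun Q => A * N3 Q) (fun Q => B * M3 Q) (fun Q _ => hj0 Q) (fun Q _ => hjQ Q)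
    have hb1 : ∑ Q : Plaq P (j + 1), (A * N3 Q) ^ 2 = A ^ 2 * ∑ Q : Plaq P (j + 1), (N3 Q) ^ 2 := by
      rw [Finset.mul_sum]; exact Finset.sum_congr rfl fun Q _ => by ring
    have hb2 := fineBond_nbhd3_schur hj g
    have hSb : √(∑ Q : Plaq P (j + 1), (A * N3 Q) ^ 2) ≤ A * √(((3 ^ P.d * P.L ^ P.d * P.d : ℕ) : ℝ) * ((3 ^ P.d * P.d ^ 2 : ℕ) : ℝ)) * √(∑ c : PBond P j, g c ^ 2) := by
      rw [hb1]
      calc √(A ^ 2 * ∑ Q : Plaq P (j + 1), (N3 Q) ^ 2) ≤ √(A ^ 2 * ((((3 ^ P.d * P.L ^ P.d * P.d : ℕ) : ℝ) * ((3 ^ P.d * P.d ^ 2 : ℕ) : ℝ)) * ∑ c : PBond P j, g c ^ 2)) :=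
            Real.sqrt_le_sqrt (mul_le_mul_of_nonneg_left hb2 (sq_nonneg _))
        _ = A * √(((3 ^ P.d * P.L ^ P.d * P.d : ℕ) : ℝ) * ((3 ^ P.d * P.d ^ 2 : ℕ) : ℝ)) * √(∑ c : PBond P j, g c ^ 2) := by
            rw [Real.sqrt_mul (sq_nonneg _), Real.sqrt_sq hA0, Real.sqrt_mul (by positivity)]; ring
    have hp1 : ∑ Q : Plaq P (j + 1), (B * M3 Q) ^ 2 = B ^ 2 * ∑ Q : Plaq P (j + 1), (M3 Q) ^ 2 := by
      rw [Finset.mul_sum]; exact Finset.sum_congr rfl fun Q _ => by ring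
    have hp2 := FluctuationComparisonRegPrIntLS2BetaNeighbourhoodKernelTorus.nbhd_schur hj fδ
    have hSp : √(∑ Q : Plaq P (j + 1), (B * M3 Q) ^ 2) ≤ B * √(((3 ^ P.d * P.L ^ P.d * P.d ^ 2 : ℕ) : ℝ) * ((3 ^ P.d * P.d ^ 2 : ℕ) : ℝ)) * √(∑ q : Plaq P j, fδ q ^ 2) := by
      rw [hp1]
      calc √(B ^ 2 * ∑ Q : Plaq P (j + 1), (M3 Q) ^ 2) ≤ √(B ^ 2 * ((((3 ^ P.d * P.L ^ P.d * P.d ^ 2 : ℕ) : ℝ) * ((3 ^ P.d * P.d ^ 2 : ℕ) : ℝ)) * ∑ q : Plaq P j, fδ q ^ 2)) :=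
            Real.sqrt_le_sqrt (mul_le_mul_of_nonneg_left hp2 (sq_nonneg _))
        _ = B * √(((3 ^ P.d * P.L ^ P.d * P.d ^ 2 : ℕ) : ℝ) * ((3 ^ P.d * P.d ^ 2 : ℕ) : ℝ)) * √(∑ q : Plaq P j, fδ q ^ 2) := by
            rw [Real.sqrt_mul (sq_nonneg _), Real.sqrt_sq hB0, Real.sqrt_mul (by positivity)]; ring
    have hfin := hMink.trans (add_le_add hSb hSp)
    rw [hA', hB, hκW, hκA, hT₀] at hfin
    linarith [hfin]

end Summit.QuantumFields.YangMills.Theorems.FluctuationComparisonRegPrIntLS2BetaRelativeHstepHjArc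

end
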